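import Summits.BirchSwinnertonDyer.BirchSwinnertonDyer.Theorems.SylvesterTwoHeegnerIndexUpperHalfContent
import HarnessLib

/-!
# Route `SylvesterTwoHeegnerIndex` (rung K7t), crux `HeegnerIndexUpperAtTwoHSY` (item 19229):
# INSTANCES — the crux's inequality in every Heegner frame of the members `E₇ = 441b`, `E₁₃ = 4563b`
# (conductor `< 5000`: Creutz–Miller 2012), and the `Ш[2]`-free locus (the crux there = `2`-integrality
# of `#Ш_an(E_p)`)

HONEST FRAMING (cell «bsd-cm», `run/shared/lean/pub/bsd-cm/`, D-0033 tranche 1a; D-0074 seat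
`bsd-cm-k7t-c2`, item stmt-BirchSwinnertonDyer-19229): sequel of
`SylvesterTwoHeegnerIndexUpperHalfContent.lean` (the crux ⟺ `∀` members, `MissingUpperBoundAt W 2`,
modulo `PublishedFactsTwo`). Nothing asserted; published inputs are explicit binders; the class 𝒞_HSY at
`p = 2` (B14 / O12) stays OPEN; nothing booked. Companion witnesses already in the tree: x1b's
`sylvesterTwoHeegnerIndex_heegnerIndexUpperAtTwoHSY_thirteen` (the `p = 13` instance from two displayed
PER-CURVE CERTIFICATES, kit j248187/j248259) — the instances below rest instead on a PUBLISHED theorem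
(Creutz–Miller 2012) and display only the conductor value; k7t-c3's
`SylvesterTwoHeegnerIndexStrictSelmerBookkeeping.lean` (the skeleton's bookkeeping modulo GZK).

* `upperInstance_of_conductor_lt`, `upper_sylvesterCurve_seven`, `upper_sylvesterCurve_thirteen` — for
  the two members of 𝒞_HSY of conductor `< 5000` the crux's inequality in EVERY frame follows from
  PUBLISHED theorems (Hu–Shu–Yin 2019 Thm 1.3: rank `1`; Creutz–Miller 2012 Thm 1.1 = tree fact
  `bsdTriple_of_rank_le_one_of_conductor_lt`: full BSD for rank `≤ 1`, `N < 5000`, computer-assisted in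
  print; Gross–Zagier, Kolyvagin, GZK, modularity, Burungale–Flach for the frame's `𝔮 = #Ш_an`) modulo
  ONE displayed Cremona datum, the conductor value (`441 = 9·7²` resp. `4563 = 27·13²`). This is the
  planner's `stub_heegnerIndexUpper_13` (START-HERE g13, SECOND ACT) in its honest form: relative to
  print, no Heegner index computed or smuggled.
* `upperInstance_of_shaTwo_trivial_of_twoIntegral` — on the `Ш[2]`-FREE locus (`#Ш(W)[2^∞] = 1`, per
  member a `2`-descent statement) the crux's inequality at `W` is EXACTLY the `2`-INTEGRALITY of
  `#Ш_an(W)` (`∃ q, #Ш_an(W) = q ∧ 0 ≤ ord₂ q`); recorded because in Hu–Shu–Yin's currency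
  (`#Ш_an(E_p)·#Ш(E_{3p²}) = 2^i·r(p)²`, cell memo MEMO-bsd-cm-two v2.5 §15 Thm B′/B″/C, paper-proved)
  that integrality is AUTOMATIC whenever `Ш(E_{3p²})[2] = 0` — so the crux restricted to
  `{Ш(E_p)[2] = 0 ∧ Ш(E_{3p²})[2] = 0} ⊇ 𝒰` is a paper theorem of the cell and its kernel form is typing
  work (HSY Cor 4.4 as a named fact, the odd-index lemma, CM heights), NOT Euler-system content; the
  Euler-system content of the crux lives off that locus.

References: [CreutzMiller2012] Thm 1.1; [HuShuYin2019] Thm 1.3/1.4, Cor 4.4; [BurungaleFlach2024] Thm 1.1,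
Cor. 2; [Miller2011LMS] Def. 1.1; [LiLiuTian2024] Thm 1.2 (the `Ш[2^∞] = 0` shape); parent
`Theorems/SylvesterTwoHeegnerIndexUpperHalfContent.lean`.
-/

set_option autoImplicit false
set_option linter.dupNamespace false

noncomputable section

open scoped Classical

open WeierstrassCurve NumberField Literature.NumberTheory.EllipticCurves
  Literature.NumberTheory.EllipticCurves.ModularForms
  Literature.NumberTheory.EllipticCurves.Rank1Residual
  Literature.NumberTheory.EllipticCurves.Rank1Residual.Typed
  Literature.NumberTheory.EllipticCurves.HuShuYin2019
  Summit.BirchSwinnertonDyer.Rank1Residual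
  Summit.BirchSwinnertonDyer.Rank1Residual.P2
  Summit.BirchSwinnertonDyer.BirchSwinnertonDyer.Theses.SylvesterTwoHeegnerIndex

namespace Summit.BirchSwinnertonDyer.BirchSwinnertonDyer.Theorems.SylvesterTwoUpper

/-! ## §1 The members of conductor `< 5000`: the crux's instances at `p = 7` and `p = 13` are PRINT -/

/-- **The crux's inequality in EVERY frame for a member of 𝒞_HSY of conductor `< 5000`, from PUBLISHED
theorems**: Hu–Shu–Yin 2019 Thm 1.3 (`hHSY`: rank `E_p(ℚ) = 1`), Creutz–Miller 2012 Thm 1.1 (`hCM`: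
full BSD for rank `≤ 1` and `N < 5000`, computer-assisted in print), hence `BSD(W, 2)`
(`forall_bsdp_of_bsdTriple'`), hence the instance (`upperInstance_of_bsdp_two`: Gross–Zagier, Kolyvagin,
GZK, modularity, Burungale–Flach). The conductor value is a displayed Cremona datum `hN`.
[cite: CreutzMiller2012, Thm 1.1 and the remark following it] [cite: HuShuYin2019, Thm. 1.3 (p. 3)]
[cite: Miller2011LMS, Def. 1.1] -/
theorem upperInstance_of_conductor_lt
    (hHSY : thm14_threePart_product) (hCM : bsdTriple_of_rank_le_one_of_conductor_lt)
    (hGZK : rank_eq_analyticRank_of_analyticRank_le_one) (hmod : hasEntireLFunction_rat)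
    (hBF : bsdTriple_of_hasCM_of_L_one_ne_zero)
    {p : ℕ} (hp : p.Prime) (h9 : p % 9 = 4 ∨ p % 9 = 7) (h3 : ¬ ∃ x : ZMod p, x ^ 3 = 3)
    (W : WeierstrassCurve ℚ) [W.IsElliptic] [W.IsGloballyMinimal]
    (hW : ∃ C : VariableChange ℚ, C • W = cubeSumCurve (p : ℚ)) (hN : W.conductorNorm ℤ < 5000)
    (N : ℕ) [NeZero N] (K : Type) [Field K] [NumberField K]
    (Dt : ModularParametrizationData W N) (H : HeegnerDatum N (NumberField.discr K)) (ι : K →+* ℂ)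
    (P : (W.baseChange K).toAffine.Point) (hGZ : gross_zagier N W K) (hKo : kolyvagin N W K)
    (hK : IsImaginaryQuadratic K) (hHN : SatisfiesHeegnerHypothesis N K)
    (hP : WeierstrassCurve.Affine.Point.map ι.toRatAlgHom P = heegnerPointComplex Dt H)
    (hLt : (W.quadraticTwist (NumberField.discr K : ℚ)).entireLFunction 1 ≠ 0)
    (Wd : WeierstrassCurve ℚ) [Wd.IsElliptic] [Wd.IsGloballyMinimal] (Cd : VariableChange ℚ)
    (hWd : Cd • W.quadraticTwist (NumberField.discr K : ℚ) = Wd) (k : ℕ) (hk12 : k = 1 ∨ k = 2)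
    (hkiff : k = 2 ↔ ∀ y : W.toAffine.Point, ∃ Q : (W.baseChange K).toAffine.Point,
      QuadraticDescent.incl K W y - (2 : ℤ) • Q ∈ AddCommGroup.torsion (W.baseChange K).toAffine.Point) :
    (padicValNat 2 (Nat.card W.sha) : ℤ) ≤ padicValRat 2 (cmHeegnerIndexQuotient W K P Dt.c k Wd Cd.u) := by
  -- rank one from Hu–Shu–Yin (the rank-zero partner's globally minimal model exists)
  have hn : (3 * (p : ℚ) ^ 2) ≠ 0 :=
    mul_ne_zero (by norm_num) (pow_ne_zero _ (Nat.cast_ne_zero.mpr hp.ne_zero))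
  haveI := X12.CubeSumFamilies.isElliptic_cubeSumCurve hn
  obtain ⟨A, _, _, CA, hA⟩ :=
    X12.CubeSumFamilies.exists_isGloballyMinimal_model (cubeSumCurve (3 * (p : ℚ) ^ 2))
  obtain ⟨hrk, hr, -⟩ := hHSY p hp h9 h3 A W hW ⟨CA, hA⟩
  -- Creutz–Miller: full BSD for `W`, hence `BSD(W, 2)`
  have hT : W.BSDTriple := hCM W (by rw [hrk]) hN
  have hb : BSDp W 2 := forall_bsdp_of_bsdTriple' W hT 2 Nat.prime_two
  exact upperInstance_of_bsdp_two W N K Dt H ι P hGZ hKo hGZK hmod hBF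
    (X12.Sylvester.hasCM_of_model W hW) hr hK hHN hP hLt Wd Cd hWd k hk12 hkiff hb

/-- `7` and `13` are members of 𝒞_HSY: `7 ≡ 7`, `13 ≡ 4 (mod 9)`, and `3` is not a cube modulo `7`
(cubes `{0, ±1}`) nor modulo `13` (cubes `{0, ±1, ±5}`). [cite: HuShuYin2019, Thm. 1.4 (p. 3)] -/
theorem seven_and_thirteen_mem :
    ((7 % 9 = 4 ∨ 7 % 9 = 7) ∧ ¬ ∃ x : ZMod 7, x ^ 3 = 3) ∧
      ((13 % 9 = 4 ∨ 13 % 9 = 7) ∧ ¬ ∃ x : ZMod 13, x ^ 3 = 3) := by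
  refine ⟨⟨by decide, ?_⟩, ⟨by decide, ?_⟩⟩ <;> decide

/-- **T3-shaped instance at `p = 7` (`E₇ = 441b`, `N = 441 < 5000`): the crux's inequality in EVERY
Heegner frame of the globally minimal model `sylvesterCurve 7 = [0,0,7,0,−343]`**, from the published
facts (Hu–Shu–Yin 2019, Creutz–Miller 2012, Gross–Zagier, Kolyvagin, GZK, modularity, Burungale–Flach
2024) and the displayed Cremona datum `hN : N = 441`. Relative to print only; nothing certified in-kernel.
[cite: CreutzMiller2012, Thm 1.1] [cite: HuShuYin2019, Thm. 1.3 and Thm. 1.4 (p. 3)] -/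
theorem upper_sylvesterCurve_seven
    (hHSY : thm14_threePart_product) (hCM : bsdTriple_of_rank_le_one_of_conductor_lt)
    (hGZK : rank_eq_analyticRank_of_analyticRank_le_one) (hmod : hasEntireLFunction_rat)
    (hBF : bsdTriple_of_hasCM_of_L_one_ne_zero) :
    haveI := X12.Sylvester.isElliptic_sylvesterCurve (p := 7) (by decide)
    haveI := X12.Sylvester.isGloballyMinimal_sylvesterCurve (p := 7) (by norm_num) (by decide)
    ∀ (_hN : (X12.Sylvester.sylvesterCurve 7).conductorNorm ℤ = 441)
      (N : ℕ) [NeZero N] (K : Type) [Field K] [NumberField K]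
      (Dt : ModularParametrizationData (X12.Sylvester.sylvesterCurve 7) N)
      (H : HeegnerDatum N (NumberField.discr K)) (ι : K →+* ℂ)
      (P : ((X12.Sylvester.sylvesterCurve 7).baseChange K).toAffine.Point)
      (Wd : WeierstrassCurve ℚ) [Wd.IsElliptic] [Wd.IsGloballyMinimal] (Cd : VariableChange ℚ) (k : ℕ),
      gross_zagier N (X12.Sylvester.sylvesterCurve 7) K → kolyvagin N (X12.Sylvester.sylvesterCurve 7) K →
      IsImaginaryQuadratic K → SatisfiesHeegnerHypothesis N K →
      WeierstrassCurve.Affine.Point.map ι.toRatAlgHom P = heegnerPointComplex Dt H →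
      ((X12.Sylvester.sylvesterCurve 7).quadraticTwist (NumberField.discr K : ℚ)).entireLFunction 1 ≠ 0 →
      Cd • (X12.Sylvester.sylvesterCurve 7).quadraticTwist (NumberField.discr K : ℚ) = Wd →
      (k = 1 ∨ k = 2) →
      (k = 2 ↔ ∀ y : (X12.Sylvester.sylvesterCurve 7).toAffine.Point,
        ∃ Q : ((X12.Sylvester.sylvesterCurve 7).baseChange K).toAffine.Point,
          QuadraticDescent.incl K (X12.Sylvester.sylvesterCurve 7) y - (2 : ℤ) • Q ∈
            AddCommGroup.torsion ((X12.Sylvester.sylvesterCurve 7).baseChange K).toAffine.Point) →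
      (padicValNat 2 (Nat.card (X12.Sylvester.sylvesterCurve 7).sha) : ℤ) ≤
        padicValRat 2 (cmHeegnerIndexQuotient (X12.Sylvester.sylvesterCurve 7) K P Dt.c k Wd Cd.u) := by
  intro hN N _ K _ _ Dt H ι P Wd _ _ Cd k hGZ hKo hK hHN hP hLt hWd hk12 hkiff
  haveI := X12.Sylvester.isElliptic_sylvesterCurve (p := 7) (by decide)
  haveI := X12.Sylvester.isGloballyMinimal_sylvesterCurve (p := 7) (by norm_num) (by decide)
  exact upperInstance_of_conductor_lt hHSY hCM hGZK hmod hBF (p := 7) (by norm_num)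
    seven_and_thirteen_mem.1.1 seven_and_thirteen_mem.1.2 (X12.Sylvester.sylvesterCurve 7)
    (X12.Sylvester.exists_smul_sylvesterCurve 7) (by rw [hN]; norm_num) N K Dt H ι P hGZ hKo hK hHN
    hP hLt Wd Cd hWd k hk12 hkiff

/-- **T3-shaped instance at `p = 13` (`E₁₃ = 4563b`, `N = 4563 = 27·13² < 5000`; the planner's
`stub_heegnerIndexUpper_13`): the crux's inequality in EVERY Heegner frame of the globally minimal model
`sylvesterCurve 13 = [0,0,13,0,−1183]`**, from the published facts and the displayed Cremona datum
`hN : N = 4563`. Relative to print only; nothing certified in-kernel.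
[cite: CreutzMiller2012, Thm 1.1] [cite: HuShuYin2019, Thm. 1.3 and Thm. 1.4 (p. 3)] -/
theorem upper_sylvesterCurve_thirteen
    (hHSY : thm14_threePart_product) (hCM : bsdTriple_of_rank_le_one_of_conductor_lt)
    (hGZK : rank_eq_analyticRank_of_analyticRank_le_one) (hmod : hasEntireLFunction_rat)
    (hBF : bsdTriple_of_hasCM_of_L_one_ne_zero) :
    haveI := X12.Sylvester.isElliptic_sylvesterCurve (p := 13) (by decide)
    haveI := X12.Sylvester.isGloballyMinimal_sylvesterCurve (p := 13) (by norm_num) (by decide)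
    ∀ (_hN : (X12.Sylvester.sylvesterCurve 13).conductorNorm ℤ = 4563)
      (N : ℕ) [NeZero N] (K : Type) [Field K] [NumberField K]
      (Dt : ModularParametrizationData (X12.Sylvester.sylvesterCurve 13) N)
      (H : HeegnerDatum N (NumberField.discr K)) (ι : K →+* ℂ)
      (P : ((X12.Sylvester.sylvesterCurve 13).baseChange K).toAffine.Point)
      (Wd : WeierstrassCurve ℚ) [Wd.IsElliptic] [Wd.IsGloballyMinimal] (Cd : VariableChange ℚ) (k : ℕ),
      gross_zagier N (X12.Sylvester.sylvesterCurve 13) K → kolyvagin N (X12.Sylvester.sylvesterCurve 13) K →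
      IsImaginaryQuadratic K → SatisfiesHeegnerHypothesis N K →
      WeierstrassCurve.Affine.Point.map ι.toRatAlgHom P = heegnerPointComplex Dt H →
      ((X12.Sylvester.sylvesterCurve 13).quadraticTwist (NumberField.discr K : ℚ)).entireLFunction 1 ≠ 0 →
      Cd • (X12.Sylvester.sylvesterCurve 13).quadraticTwist (NumberField.discr K : ℚ) = Wd →
      (k = 1 ∨ k = 2) →
      (k = 2 ↔ ∀ y : (X12.Sylvester.sylvesterCurve 13).toAffine.Point,
        ∃ Q : ((X12.Sylvester.sylvesterCurve 13).baseChange K).toAffine.Point,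
          QuadraticDescent.incl K (X12.Sylvester.sylvesterCurve 13) y - (2 : ℤ) • Q ∈
            AddCommGroup.torsion ((X12.Sylvester.sylvesterCurve 13).baseChange K).toAffine.Point) →
      (padicValNat 2 (Nat.card (X12.Sylvester.sylvesterCurve 13).sha) : ℤ) ≤
        padicValRat 2 (cmHeegnerIndexQuotient (X12.Sylvester.sylvesterCurve 13) K P Dt.c k Wd Cd.u) := by
  intro hN N _ K _ _ Dt H ι P Wd _ _ Cd k hGZ hKo hK hHN hP hLt hWd hk12 hkiff
  haveI := X12.Sylvester.isElliptic_sylvesterCurve (p := 13) (by decide)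
  haveI := X12.Sylvester.isGloballyMinimal_sylvesterCurve (p := 13) (by norm_num) (by decide)
  exact upperInstance_of_conductor_lt hHSY hCM hGZK hmod hBF (p := 13) (by norm_num)
    seven_and_thirteen_mem.2.1 seven_and_thirteen_mem.2.2 (X12.Sylvester.sylvesterCurve 13)
    (X12.Sylvester.exists_smul_sylvesterCurve 13) (by rw [hN]; norm_num) N K Dt H ι P hGZ hKo hK hHN
    hP hLt Wd Cd hWd k hk12 hkiff

/-! ## §2 The `Ш[2]`-free locus: there the crux is the `2`-integrality of `#Ш_an` -/

section ShaTwoFree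

variable (W : WeierstrassCurve ℚ) [W.IsElliptic] [W.IsGloballyMinimal]
  (N : ℕ) [NeZero N] (K : Type) [Field K] [NumberField K]
  (Dt : ModularParametrizationData W N) (H : HeegnerDatum N (NumberField.discr K)) (ι : K →+* ℂ)
  (P : (W.baseChange K).toAffine.Point)

/-- **On the `Ш[2]`-free locus the crux's inequality is the `2`-integrality of `#Ш_an`.** For a
globally minimal CM `W` of analytic rank one with `#Ш(W)[2^∞] = 1` (per member: a `2`-descent statement,
e.g. Hu–Shu–Yin's `E_p` with `rk₂ Cl(ℚ(∛4p)) = 0`, cell memo Thm A) and `#Ш_an(W) = q` with `0 ≤ ord₂ q`,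
the crux's inequality holds in every Heegner frame: `ord₂ #Ш(W) = ord₂ #Ш(W)[2^∞] = 0 ≤ ord₂ q = ord₂ 𝔮`
(`Ш(W)` finite by GZK; `𝔮 = #Ш_an(W)` by the `L`-free identity). The Li–Liu–Tian shape of the upper half.
[cite: LiLiuTian2024, Thm. 1.2 and its proof] [cite: Miller2011LMS, Def. 1.1] -/
theorem upperInstance_of_shaTwo_trivial_of_twoIntegral
    (hGZ : gross_zagier N W K) (hKo : kolyvagin N W K)
    (hGZK : rank_eq_analyticRank_of_analyticRank_le_one) (hmod : hasEntireLFunction_rat)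
    (hBF : bsdTriple_of_hasCM_of_L_one_ne_zero)
    (hcm : W.HasCM) (hr : W.analyticRank = 1) (hK : IsImaginaryQuadratic K)
    (hHN : SatisfiesHeegnerHypothesis N K)
    (hP : WeierstrassCurve.Affine.Point.map ι.toRatAlgHom P = heegnerPointComplex Dt H)
    (hLt : (W.quadraticTwist (NumberField.discr K : ℚ)).entireLFunction 1 ≠ 0)
    (Wd : WeierstrassCurve ℚ) [Wd.IsElliptic] [Wd.IsGloballyMinimal] (Cd : VariableChange ℚ)
    (hWd : Cd • W.quadraticTwist (NumberField.discr K : ℚ) = Wd) (k : ℕ) (hk12 : k = 1 ∨ k = 2)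
    (hkiff : k = 2 ↔ ∀ y : W.toAffine.Point, ∃ Q : (W.baseChange K).toAffine.Point,
      QuadraticDescent.incl K W y - (2 : ℤ) • Q ∈ AddCommGroup.torsion (W.baseChange K).toAffine.Point)
    (hSha2 : Nat.card (AddCommGroup.primaryComponent W.sha 2) = 1)
    (hint : ∃ q : ℚ, shaAn W = (q : ℂ) ∧ 0 ≤ padicValRat 2 q) :
    (padicValNat 2 (Nat.card W.sha) : ℤ) ≤ padicValRat 2 (cmHeegnerIndexQuotient W K P Dt.c k Wd Cd.u) := by
  haveI : Fact (2 : ℕ).Prime := ⟨Nat.prime_two⟩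
  haveI : Finite W.sha := (hGZK W (by rw [hr])).2
  obtain ⟨q, hq, hq0⟩ := hint
  refine upperInstance_of_missingUpperBoundAt W N K Dt H ι P hGZ hKo hGZK hmod hBF hcm hr hK hHN hP hLt
    Wd Cd hWd k hk12 hkiff ⟨q, hq, ?_⟩
  rw [WeierstrassCurve.shaOrder, ← padicValNat_card_addPrimaryComponent 2, hSha2, padicValNat_one_right]
  exact_mod_cast hq0

end ShaTwoFree

end Summit.BirchSwinnertonDyer.BirchSwinnertonDyer.Theorems.SylvesterTwoUpper

end
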